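import Literature.MathematicalPhysics.KineticTheory.CollisionTubePairMeanLowerBound
import HarnessLib

/-!
# Splitting floor at rung 0 (helper of `stub_splitFloorRung0`, line `level-census-comparison`,
# crux `EnergyCurrentTails`, stmt-AtomisticToContinuum-9235): the one-sided tube mean for a
# MEASURABLE mark

Helper file of the rung-0 certificate `stub_splitFloorRung0` of the splitting floor F3 of the line
`level-census-comparison` (objects in `…Theorems.OneFlightGossipEngineEnergyCurrentTailsLevelCensusObjects`).
The static input of the floor is the one-sided tube mean of
`Literature/MathematicalPhysics/KineticTheory/CollisionTubePairMeanLowerBound.lean`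
(`pair_tubeMark_mean_ge`, `sum_pair_tubeMark_mean_ge`), stated there for CONTINUOUS marks `Ξ`.  The
splitting floor evaluates the tube functional at the EXACT indicator mark of the splitting geometry (a
bounded measurable, discontinuous mark: the closed energy shell `(E, 3E/2]` of the crux statement leaves
no room for continuous margins), so this file re-derives the two bounds for MEASURABLE bounded marks;
continuity entered the cited proofs only through the Fubini measurability of the sphere-integrated
mark `Θ Ξ (v, v') = ∫_{S²} Ξ(ω, v, v') ((v' − v)·ω)₊ dω`, which holds for every measurable `Ξ`
(`measurable_sphereMark_of_measurable`).

* `pair_tubeMark_mean_ge_of_measurable` — `(∫χ) (1 − 16λ) ε_N³ κ Θ̄_Ξ ≤ E_{G_N}[χ(xᵢ) pairTubeMark ε_N κ Ξ i j]`;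
* `sum_pair_tubeMark_mean_ge_of_measurable` — summed over the `(N+1)N` ordered pairs (registered
  helper `splitFloorRung0_tubeMean`, `∀`-form).

Proofs adapted verbatim from the cited file (Ruelle's one-sided pair bound, Fubini, translation
invariance of the canonical position law; no contact theorem).

References: D. Ruelle, *Statistical Mechanics: Rigorous Results* (1969) §4.2; C. Cercignani,
R. Illner, M. Pulvirenti (1994) §2.2.
-/

noncomputable section

open MeasureTheory ProbabilityTheory Set Filter Topology Function
open scoped ENNReal InnerProductSpace BigOperators Pointwise

namespace Summit.AtomisticToContinuum.HydrodynamicLimit.Theorems.EnergyCurrentTailsLevelCensus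

open Literature.MathematicalPhysics.KineticTheory Literature.Analysis.FluidPDE
open Literature.MathematicalPhysics.StatisticalMechanics

/-- The sphere-integrated mark of a MEASURABLE mark is jointly measurable in `(v, w)` (Fubini
measurability of a parametric integral with jointly measurable real integrand). [folklore] -/
theorem measurable_sphereMark_of_measurable {Ξ : V3 × V3 × V3 → ℝ} (hΞ : Measurable Ξ) :
    Measurable fun p : V3 × V3 => sphereMark Ξ p.1 p.2 := by
  haveI := isFiniteMeasure_sphereMeasure (E := V3)
  have hm : Measurable (uncurry fun (p : V3 × V3) (ω : Metric.sphere (0 : V3) 1) =>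
      Ξ ((ω : V3), p.1, p.2) * hardSphereKernel (p.2, p.1) ω) := by
    have h1 : Measurable fun q : (V3 × V3) × Metric.sphere (0 : V3) 1 =>
        Ξ ((q.2 : V3), q.1.1, q.1.2) :=
      hΞ.comp ((continuous_subtype_val.comp continuous_snd).measurable.prodMk
        (measurable_fst.fst.prodMk measurable_fst.snd))
    have h2 : Measurable fun q : (V3 × V3) × Metric.sphere (0 : V3) 1 =>
        hardSphereKernel (q.1.2, q.1.1) q.2 := by
      unfold hardSphereKernel
      fun_prop
    exact h1.mul h2
  exact (hm.stronglyMeasurable.integral_prod_right'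
    (ν := (sphereMeasure : Measure (Metric.sphere (0 : V3) 1)))).measurable

-- adapted from Literature/MathematicalPhysics/KineticTheory/CollisionTubePairMeanLowerBound.lean
-- (`pair_tubeMark_mean_ge`, continuity of the mark weakened to measurability)
/-- **One ordered pair has at least `(1 − 16λ)` times the ideal tube mean at rung 0, for every nonnegative
MEASURABLE bounded mark with a speed cutoff.**  For constant profiles `a, θ > 0`, `u`,
`SmallDensity uniformProfile σ`, `i ≠ j`, continuous `χ ≥ 0`, a measurable mark `0 ≤ Ξ ≤ C` vanishing at
relative speed `‖v − v'‖ ≥ 2L` (`L ≥ 0`), `κ ≥ 0` with `ε_N (1 + 2Lκ) < 1/2`: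
`(∫ χ) · (1 − 16λ) ε_N³ κ Θ̄_Ξ ≤ E_{G_N}[χ(xᵢ) · tubeMark κ Ξ (ε⁻¹ sepVec xᵢ xⱼ) vᵢ vⱼ]`. [folklore] -/
theorem pair_tubeMark_mean_ge_of_measurable {σ a θ : ℝ} {u : V3} {N : ℕ}
    (Φ : HardSphereFlow (Torus.geometry (Fin 3)) (hsDiameter σ N) (N + 1))
    {i j : Fin (N + 1)} (hij : i ≠ j) (hsd : SmallDensity uniformProfile σ) (ha : 0 < a) (hθ : 0 < θ)
    {χ : T3 → ℝ} (hχ : Continuous χ) (hχ0 : ∀ y, 0 ≤ χ y)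
    {Ξ : V3 × V3 × V3 → ℝ} (hΞm : Measurable Ξ) {C : ℝ} (hΞC : ∀ p, |Ξ p| ≤ C) (hΞ0 : ∀ p, 0 ≤ Ξ p)
    {L κ : ℝ} (hL : 0 ≤ L) (hκ : 0 ≤ κ) (hΞL : ∀ m v v' : V3, 2 * L ≤ ‖v - v'‖ → Ξ (m, v, v') = 0)
    (hsmall : hsDiameter σ N * (1 + 2 * L * κ) < 1 / 2) :
    (∫ y, χ y) * ((1 - 16 * ovDensity uniformProfile σ) * hsDiameter σ N ^ 3 * κ *
        ∫ p : V3 × V3, sphereMark Ξ p.1 p.2 * (localMaxwellian 1 θ u p.1 * localMaxwellian 1 θ u p.2)) ≤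
      ∫ z, χ (z i).1 * pairTubeMark (hsDiameter σ N) κ Ξ i j (fun m => (z m).1) (fun m => (z m).2)
        ∂(localGibbsLaw σ (fun _ => a) (fun _ => u) (fun _ => θ) N Φ) := by
  have hσ := hsd.σ_pos
  have hσ2 : σ ≤ 1 / 2 := hsd.σ_lt_half.le
  have hε : 0 < hsDiameter σ N := hsDiameter_pos hσ N
  haveI hPprob : IsProbabilityMeasure (posGibbsMeasure (fun _ : T3 => a) (hsDiameter σ N) (N + 1)) :=
    isProbabilityMeasure_posGibbsMeasure continuous_const (fun _ => ha) hσ2 N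
  have hC0 : 0 ≤ C := (abs_nonneg _).trans (hΞC (0, 0, 0))
  have hφb : ∀ x v, |pairTubeMark (hsDiameter σ N) κ Ξ i j x v| ≤ C :=
    abs_pairTubeMark_le _ _ hΞC i j
  -- the disintegration
  rw [integral_localGibbsLaw_mul_shiftInvariant Φ hσ2 ha hθ hχ i
    (measurable_pairTubeMark (hsDiameter σ N) κ hΞm i j) hφb
    (pairTubeMark_add_const (hsDiameter σ N) κ Ξ i j)]
  -- the configurational lower bound for the pair (activity `a` = activity `1`)
  set c : ℝ := (1 - 16 * ovDensity uniformProfile σ) * hsDiameter σ N ^ 3 with hcdef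
  have hCP : ∀ S : Set V3, MeasurableSet S → S ⊆ {q | 1 < ‖q‖ ∧ ‖q‖ ≤ 1 + 2 * L * κ} →
      c * (volume : Measure V3).real S ≤
        (posGibbsMeasure (fun _ : T3 => a) (hsDiameter σ N) (N + 1)).real
          {x | Torus.reprSym (x i - x j) ∈ hsDiameter σ N • S} := by
    intro S hS hSsub
    rw [posGibbsMeasure_const_eq_one ha]
    have h := posGibbs_rescaledPairEvent_ge hsd hij hsmall hS hSsub
    rwa [← mul_assoc] at h
  -- the position average for fixed velocities
  have key : ∀ v : Fin (N + 1) → V3, c * κ * sphereMark Ξ (v i) (v j) ≤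
      ∫ x, pairTubeMark (hsDiameter σ N) κ Ξ i j x v ∂posGibbsMeasure (fun _ : T3 => a) (hsDiameter σ N) (N + 1) :=
    fun v => integral_tubeMark_ge (posGibbsMeasure (fun _ : T3 => a) (hsDiameter σ N) (N + 1)) hε i j hΞm hΞC
      hΞ0 hκ le_rfl hΞL hCP (v i) (v j)
  -- the velocity average
  have hΘm : Measurable fun p : V3 × V3 => sphereMark Ξ p.1 p.2 := measurable_sphereMark_of_measurable hΞm
  have hpair : ∫ v, sphereMark Ξ (v i) (v j) ∂Measure.pi (fun _ : Fin (N + 1) => gaussMeasure u θ) =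
      ∫ p : V3 × V3, sphereMark Ξ p.1 p.2 * (localMaxwellian 1 θ u p.1 * localMaxwellian 1 θ u p.2) :=
    integral_pi_pair_gauss hθ u hij (f := fun p : V3 × V3 => sphereMark Ξ p.1 p.2) hΘm
  have hsw : StronglyMeasurable (uncurry fun (v : Fin (N + 1) → V3) (x : Fin (N + 1) → T3) =>
      pairTubeMark (hsDiameter σ N) κ Ξ i j x v) := by
    have h := ((measurable_pairTubeMark (hsDiameter σ N) κ hΞm i j).comp measurable_swap).stronglyMeasurable
    exact h
  have hIm : Measurable fun v : Fin (N + 1) → V3 =>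
      ∫ x, pairTubeMark (hsDiameter σ N) κ Ξ i j x v ∂posGibbsMeasure (fun _ : T3 => a) (hsDiameter σ N) (N + 1) :=
    hsw.integral_prod_right'.measurable
  have hIint : Integrable (fun v : Fin (N + 1) → V3 =>
      ∫ x, pairTubeMark (hsDiameter σ N) κ Ξ i j x v ∂posGibbsMeasure (fun _ : T3 => a) (hsDiameter σ N) (N + 1))
      (Measure.pi fun _ : Fin (N + 1) => gaussMeasure u θ) := by
    refine Integrable.of_bound hIm.aestronglyMeasurable C (ae_of_all _ fun v => ?_)
    have h := norm_integral_le_of_norm_le_const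
      (μ := posGibbsMeasure (fun _ : T3 => a) (hsDiameter σ N) (N + 1))
      (f := fun x => pairTubeMark (hsDiameter σ N) κ Ξ i j x v) (C := C)
      (ae_of_all _ fun x => by rw [Real.norm_eq_abs]; exact hφb x v)
    simpa only [probReal_univ, mul_one] using h
  have hvij : Measurable fun v : Fin (N + 1) → V3 => (v i, v j) :=
    (measurable_pi_apply i).prodMk (measurable_pi_apply j)
  have hΘint : Integrable (fun v : Fin (N + 1) → V3 => c * κ * sphereMark Ξ (v i) (v j))
      (Measure.pi fun _ : Fin (N + 1) => gaussMeasure u θ) := by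
    have hm := (hΘm.comp hvij).const_mul (c * κ)
    refine Integrable.of_bound hm.aestronglyMeasurable
      (|c * κ| * (C * (2 * L) * (sphereMeasure : Measure (Metric.sphere (0 : V3) 1)).real univ))
      (ae_of_all _ fun v => ?_)
    rw [Real.norm_eq_abs, abs_mul]
    exact mul_le_mul_of_nonneg_left (abs_sphereMark_le_of_speedCutoff hΞC hL hΞL _ _) (abs_nonneg _)
  have hmono : ∫ v, c * κ * sphereMark Ξ (v i) (v j) ∂Measure.pi (fun _ : Fin (N + 1) => gaussMeasure u θ) ≤
      ∫ v, ∫ x, pairTubeMark (hsDiameter σ N) κ Ξ i j x v ∂posGibbsMeasure (fun _ : T3 => a) (hsDiameter σ N) (N + 1)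
        ∂Measure.pi (fun _ : Fin (N + 1) => gaussMeasure u θ) :=
    integral_mono hΘint hIint key
  rw [integral_const_mul, hpair] at hmono
  have hχI : 0 ≤ ∫ y, χ y := integral_nonneg hχ0
  calc (∫ y, χ y) * ((1 - 16 * ovDensity uniformProfile σ) * hsDiameter σ N ^ 3 * κ *
          ∫ p : V3 × V3, sphereMark Ξ p.1 p.2 * (localMaxwellian 1 θ u p.1 * localMaxwellian 1 θ u p.2))
      = (∫ y, χ y) * (c * κ *
          ∫ p : V3 × V3, sphereMark Ξ p.1 p.2 * (localMaxwellian 1 θ u p.1 * localMaxwellian 1 θ u p.2)) := by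
        rw [hcdef]
    _ ≤ (∫ y, χ y) * ∫ v, ∫ x, pairTubeMark (hsDiameter σ N) κ Ξ i j x v
          ∂posGibbsMeasure (fun _ : T3 => a) (hsDiameter σ N) (N + 1)
          ∂Measure.pi (fun _ : Fin (N + 1) => gaussMeasure u θ) := mul_le_mul_of_nonneg_left hmono hχI

-- adapted from Literature/MathematicalPhysics/KineticTheory/CollisionTubePairMeanLowerBound.lean
-- (`sum_pair_tubeMark_mean_ge`)
/-- **The Gibbs mean of the collision-cylinder double sum is at least `(1 − 16λ)` times the ideal one, for a
measurable mark.**  Summing `pair_tubeMark_mean_ge_of_measurable` over the `(N+1)N` ordered pairs: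
`(N+1) N (∫χ) (1 − 16λ) ε_N³ κ Θ̄_Ξ ≤ E_{G_N}[Σᵢ Σⱼ [i ≠ j] χ(xᵢ) pairTubeMark ε_N κ Ξ i j]`. [folklore] -/
theorem sum_pair_tubeMark_mean_ge_of_measurable {σ a θ : ℝ} {u : V3} {N : ℕ}
    (Φ : HardSphereFlow (Torus.geometry (Fin 3)) (hsDiameter σ N) (N + 1))
    (hsd : SmallDensity uniformProfile σ) (ha : 0 < a) (hθ : 0 < θ)
    {χ : T3 → ℝ} (hχ : Continuous χ) (hχ0 : ∀ y, 0 ≤ χ y)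
    {Ξ : V3 × V3 × V3 → ℝ} (hΞm : Measurable Ξ) {C : ℝ} (hΞC : ∀ p, |Ξ p| ≤ C) (hΞ0 : ∀ p, 0 ≤ Ξ p)
    {L κ : ℝ} (hL : 0 ≤ L) (hκ : 0 ≤ κ) (hΞL : ∀ m v v' : V3, 2 * L ≤ ‖v - v'‖ → Ξ (m, v, v') = 0)
    (hsmall : hsDiameter σ N * (1 + 2 * L * κ) < 1 / 2) :
    ((N + 1 : ℕ) : ℝ) * N * ((∫ y, χ y) * ((1 - 16 * ovDensity uniformProfile σ) * hsDiameter σ N ^ 3 * κ *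
        ∫ p : V3 × V3, sphereMark Ξ p.1 p.2 * (localMaxwellian 1 θ u p.1 * localMaxwellian 1 θ u p.2))) ≤
      ∫ z, ∑ i : Fin (N + 1), ∑ j : Fin (N + 1),
          (if i ≠ j then χ (z i).1 * pairTubeMark (hsDiameter σ N) κ Ξ i j (fun m => (z m).1) (fun m => (z m).2)
            else 0)
        ∂(localGibbsLaw σ (fun _ => a) (fun _ => u) (fun _ => θ) N Φ) := by
  have hσ2 : σ ≤ 1 / 2 := hsd.σ_lt_half.le
  haveI hGprob : IsProbabilityMeasure (localGibbsLaw σ (fun _ => a) (fun _ => u) (fun _ => θ) N Φ) :=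
    isProbabilityMeasure_localGibbsLaw continuous_const continuous_const continuous_const
      (fun _ => ha) (fun _ => hθ) hσ2 N Φ
  obtain ⟨Cχ, -, hCχ⟩ := exists_forall_abs_le_of_continuous hχ
  have hCχ0 : 0 ≤ Cχ := (abs_nonneg _).trans (hCχ 0)
  set G := localGibbsLaw σ (fun _ => a) (fun _ => u) (fun _ => θ) N Φ with hGdef
  set b : ℝ := (∫ y, χ y) * ((1 - 16 * ovDensity uniformProfile σ) * hsDiameter σ N ^ 3 * κ *
    ∫ p : V3 × V3, sphereMark Ξ p.1 p.2 * (localMaxwellian 1 θ u p.1 * localMaxwellian 1 θ u p.2)) with hbdef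
  -- the summands
  set S1 : Fin (N + 1) → Fin (N + 1) → Config (N + 1) (Fin 3) T3 → ℝ := fun i j z =>
    if i ≠ j then χ (z i).1 * pairTubeMark (hsDiameter σ N) κ Ξ i j (fun m => (z m).1) (fun m => (z m).2)
      else 0 with hS1def
  have hχim : ∀ i : Fin (N + 1), Measurable fun z : Config (N + 1) (Fin 3) T3 => χ (z i).1 := fun i => by
    have h0 : Measurable fun z : Config (N + 1) (Fin 3) T3 => (z i).1 := (measurable_pi_apply i).fst
    have h := hχ.measurable.comp h0
    exact h
  have hS1m : ∀ i j, Measurable (S1 i j) := fun i j =>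
    Measurable.ite (MeasurableSet.const _) ((hχim i).mul (measurable_pairTubeMark_config (hsDiameter σ N) κ hΞm i j))
      measurable_const
  have hS1b : ∀ i j z, |S1 i j z| ≤ Cχ * C := fun i j z => by
    simp only [hS1def]
    split_ifs
    · rw [abs_mul]
      exact mul_le_mul (hCχ _) (abs_pairTubeMark_le _ _ hΞC i j _ _) (abs_nonneg _) hCχ0
    · rw [abs_zero]; exact mul_nonneg hCχ0 ((abs_nonneg _).trans (hΞC (0, 0, 0)))
  have hS1i : ∀ i j, Integrable (S1 i j) G := fun i j =>
    Integrable.of_bound (hS1m i j).aestronglyMeasurable _ (ae_of_all _ fun z => by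
      rw [Real.norm_eq_abs]; exact hS1b i j z)
  -- linearity
  have hI : ∫ z, ∑ i, ∑ j, S1 i j z ∂G = ∑ i, ∑ j, ∫ z, S1 i j z ∂G := by
    rw [integral_finsetSum _ fun i _ => integrable_finsetSum _ fun j _ => hS1i i j]
    exact Finset.sum_congr rfl fun i _ => integral_finsetSum _ fun j _ => hS1i i j
  -- pair by pair
  have hpair : ∀ i j : Fin (N + 1), (if i ≠ j then b else 0) ≤ ∫ z, S1 i j z ∂G := by
    intro i j
    by_cases hij : i ≠ j
    · rw [if_pos hij]
      have hm := pair_tubeMark_mean_ge_of_measurable (u := u) Φ hij hsd ha hθ hχ hχ0 hΞm hΞC hΞ0 hL hκ hΞL hsmall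
      have hS1 : ∫ z, S1 i j z ∂G =
          ∫ z, χ (z i).1 * pairTubeMark (hsDiameter σ N) κ Ξ i j (fun m => (z m).1) (fun m => (z m).2) ∂G :=
        integral_congr_ae (ae_of_all _ fun z => by simp only [hS1def, if_pos hij])
      rw [hS1, hbdef]
      exact hm
    · rw [if_neg hij]
      have h0 : ∫ z, S1 i j z ∂G = 0 := by simp only [hS1def, if_neg hij, integral_zero]
      rw [h0]
  show ((N + 1 : ℕ) : ℝ) * N * b ≤ ∫ z, ∑ i, ∑ j, S1 i j z ∂G
  rw [hI, ← sum_sum_ite_ne_const N b]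
  exact Finset.sum_le_sum fun i _ => Finset.sum_le_sum fun j _ => hpair i j

/-- **Registered helper `splitFloorRung0_tubeMean`** (stmt-AtomisticToContinuum-9235, line
`level-census-comparison`, input of `stub_splitFloorRung0`): `∀`-form of
`sum_pair_tubeMark_mean_ge_of_measurable`. [folklore] -/
theorem splitFloorRung0_tubeMean : ∀ (σ a θ : ℝ) (u : V3) (N : ℕ) (Φ : HardSphereFlow (Torus.geometry (Fin 3)) (hsDiameter σ N) (N + 1)), SmallDensity uniformProfile σ → 0 < a → 0 < θ → ∀ (χ : T3 → ℝ), Continuous χ → (∀ y, 0 ≤ χ y) → ∀ (Ξ : V3 × V3 × V3 → ℝ), Measurable Ξ → ∀ (C : ℝ), (∀ p, |Ξ p| ≤ C) → (∀ p, 0 ≤ Ξ p) → ∀ (L κ : ℝ), 0 ≤ L → 0 ≤ κ → (∀ m v v' : V3, 2 * L ≤ ‖v - v'‖ → Ξ (m, v, v') = 0) → hsDiameter σ N * (1 + 2 * L * κ) < 1 / 2 → ((N + 1 : ℕ) : ℝ) * N * ((∫ y, χ y) * ((1 - 16 * ovDensity uniformProfile σ) * hsDiameter σ N ^ 3 * κ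 * ∫ p : V3 × V3, sphereMark Ξ p.1 p.2 * (localMaxwellian 1 θ u p.1 * localMaxwellian 1 θ u p.2))) ≤ ∫ z, ∑ i : Fin (N + 1), ∑ j : Fin (N + 1), (if i ≠ j then χ (z i).1 * pairTubeMark (hsDiameter σ N) κ Ξ i j (fun m => (z m).1) (fun m => (z m).2) else 0) ∂(localGibbsLaw σ (fun _ => a) (fun _ => u) (fun _ => θ) N Φ) :=
  fun _σ _a _θ _u _N Φ hsd ha hθ _χ hχ hχ0 _Ξ hΞm _C hΞC hΞ0 _L _κ hL hκ hΞL hsmall =>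
    sum_pair_tubeMark_mean_ge_of_measurable Φ hsd ha hθ hχ hχ0 hΞm hΞC hΞ0 hL hκ hΞL hsmall

end Summit.AtomisticToContinuum.HydrodynamicLimit.Theorems.EnergyCurrentTailsLevelCensus

end
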